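import Summits.Parity.GeneralizedHardyLittlewood.Theorems.GreenTaoLevelTwoGITwoCyclicInverseBSGPathsThreePrelims

/-!
# Route `GreenTaoLevelTwo`, crux `GITwo` (stmt-Parity-21275), line `birth`, stub `stub_cyclicInverse`:
# towards Balog–Szemerédi–Gowers — paths of length three (assembly)

Seventh helper file toward the XL stub `stub_cyclicInverse` (B. Green, T. Tao, arXiv:math/0503014,
Thm. 68 = PEMS 51 (2008) Thm. 12.8), continuing the Balog–Szemerédi–Gowers brick (arXiv Thm. 25).
From the preliminaries (`…BSGPathsThreePrelims`: high-degree restriction, dependent random choice in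
vertex form, pruning, rich right vertices, path counting) we assemble the **paths of length three
lemma**: for a bipartite edge finset `E ⊆ A × B` with `#E ≥ #A·#B/K` (`K ≥ 1`, `A, B` nonempty)
there are `A' ⊆ A`, `B' ⊆ B` with `#A' ≥ #A/(12K²)`, `#B' ≥ #B/(4K)` such that every pair
`(a, b) ∈ A' × B'` is joined by at least `#A·#B/(2¹⁵K⁶)` paths `a — b₁ — a₁ — b`
(`exists_paths_of_length_three`).  Constants: `ε = 1/(32K)` in the dependent random choice,
poor threshold `#B/(256K³)`.

Next (not here): the BSG count — with `E` the popular-sum graph of `…BSGPopular`, each path gives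
`(#A/2K)³` sextuples representing `a + b`, whence `|A' + B'| ≤ 2¹⁸K⁹ #A` and, by Ruzsa's triangle
inequality (Mathlib), `|A' − A'| ≪ K^{O(1)} |A'|` = arXiv Thm. 25.

References: [GreenTao2008U3Inverse] arXiv:math/0503014 Thm. 25; W. T. Gowers, GAFA 8 (1998) §7;
T. Tao, V. Vu, *Additive Combinatorics*, §2.5, §6.4.
-/

namespace Summit.Parity.GeneralizedHardyLittlewood.GreenTaoLevelTwoGITwoCyclicInverse

open Finset

variable {α β : Type*} [DecidableEq α] [DecidableEq β]

/-! ### Step F: assembly -/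

set_option maxHeartbeats 400000 in
/-- **Paths of length three.** Let `E ⊆ A × B` be a bipartite edge finset with `#E ≥ #A·#B/K`,
`K ≥ 1`, `A, B` nonempty.  Then there are `A' ⊆ A` and `B' ⊆ B` with `#A' ≥ #A/(12K²)`,
`#B' ≥ #B/(4K)` such that every `(a, b) ∈ A' × B'` is joined by at least `#A·#B/(2¹⁵K⁶)` paths
`a — b₁ — a₁ — b` in `E`. [cite: GreenTao2008U3Inverse, Thm. 25 (graph-theoretic heart of the proof)] -/
theorem exists_paths_of_length_three (A : Finset α) (B : Finset β) (E : Finset (α × β))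
    (hEA : ∀ e ∈ E, e.1 ∈ A) (hEB : ∀ e ∈ E, e.2 ∈ B) (hA : A.Nonempty) (hB : B.Nonempty)
    {K : ℝ} (hK : 1 ≤ K) (hcard : (#A : ℝ) * #B / K ≤ #E) :
    ∃ A' ⊆ A, ∃ B' ⊆ B, (#A : ℝ) / (12 * K ^ 2) ≤ #A' ∧ (#B : ℝ) / (4 * K) ≤ #B' ∧
      ∀ a ∈ A', ∀ b ∈ B',
        (#A : ℝ) * #B / (2 ^ 15 * K ^ 6) ≤
          #{q ∈ B ×ˢ A | (a, q.1) ∈ E ∧ (q.2, q.1) ∈ E ∧ (q.2, b) ∈ E} := by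
  have hK0 : 0 < K := lt_of_lt_of_le one_pos hK
  have hApos : (0 : ℝ) < #A := by exact_mod_cast hA.card_pos
  have hBpos : (0 : ℝ) < #B := by exact_mod_cast hB.card_pos
  -- Step A: high-degree part (opaque abbreviations `E0`, `A0`)
  obtain ⟨E0, hE0⟩ : ∃ E0 : Finset (α × β),
      E0 = {e ∈ E | (#B : ℝ) / (2 * K) ≤ #{e' ∈ E | e'.1 = e.1}} := ⟨_, rfl⟩
  obtain ⟨A0, hA0⟩ : ∃ A0 : Finset α,
      A0 = {a ∈ A | (#B : ℝ) / (2 * K) ≤ #{e' ∈ E | e'.1 = a}} := ⟨_, rfl⟩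
  have hE0E : E0 ⊆ E := by rw [hE0]; exact filter_subset _ E
  have hE0A0 : ∀ e ∈ E0, e.1 ∈ A0 := fun e he => by
    rw [hE0, mem_filter] at he
    rw [hA0, mem_filter]
    exact ⟨hEA e he.1, he.2⟩
  have hE0B : ∀ e ∈ E0, e.2 ∈ B := fun e he => hEB e (hE0E he)
  have hA0A : A0 ⊆ A := by rw [hA0]; exact filter_subset _ A
  have hcardE0 : (#A : ℝ) * #B / (2 * K) ≤ #E0 := by
    rw [hE0]; exact card_edges_highDeg_ge A B E hEA hK0 hcard
  have hdegA0 : ∀ a ∈ A0, (#B : ℝ) / (2 * K) ≤ #{e ∈ E0 | e.1 = a} := by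
    intro a ha
    rw [hA0, mem_filter] at ha
    have heq : #{e ∈ E0 | e.1 = a} = #{e ∈ E | e.1 = a} := by
      congr 1; ext e
      rw [mem_filter, mem_filter, hE0, mem_filter]
      constructor
      · rintro ⟨⟨he, -⟩, hea⟩; exact ⟨he, hea⟩
      · rintro ⟨he, hea⟩; exact ⟨⟨he, by rw [hea]; exact ha.2⟩, hea⟩
    rw [heq]; exact ha.2
  -- `#A0 ≥ #A/(2K)`
  have hA0card : (#A : ℝ) / (2 * K) ≤ #A0 := by
    have h1 : #E0 ≤ #A0 * #B := by
      rw [← card_product]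
      exact card_le_card fun e he => mem_product.mpr ⟨hE0A0 e he, hE0B e he⟩
    have h2 : (#E0 : ℝ) ≤ #A0 * #B := by exact_mod_cast h1
    have h3 : (#A : ℝ) / (2 * K) * #B ≤ #A0 * #B := by
      calc (#A : ℝ) / (2 * K) * #B = #A * #B / (2 * K) := by ring
        _ ≤ _ := hcardE0.trans h2
    exact le_of_mul_le_mul_right h3 hBpos
  -- Step B: dependent random choice on `E0 ⊆ A0 × B` with constant `2K` and `ε = 1/(32K)`
  have hcard0 : (#A0 : ℝ) * #B / (2 * K) ≤ #E0 := by
    refine le_trans ?_ hcardE0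
    have : (#A0 : ℝ) ≤ #A := by exact_mod_cast card_le_card hA0A
    rw [div_le_div_iff_of_pos_right (by positivity)]
    exact mul_le_mul_of_nonneg_right this hBpos.le
  have hε : (0 : ℝ) < 1 / (32 * K) := by positivity
  have h2K : (0 : ℝ) < 2 * K := by positivity
  obtain ⟨b₀, -, hA1sq, hpoor⟩ :=
    exists_vertex_many_rich_pairs_nbhd A0 B E0 hE0A0 hE0B hB h2K hε hcard0
  obtain ⟨A1, hA1⟩ : ∃ A1 : Finset α, A1 = {a ∈ A0 | (a, b₀) ∈ E0} := ⟨_, rfl⟩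
  obtain ⟨γB, hγB⟩ : ∃ γB : ℝ, γB = 1 / (32 * K) / (2 * (2 * K) ^ 2) * #B := ⟨_, rfl⟩
  rw [← hA1, ← hγB] at hpoor
  rw [← hA1] at hA1sq
  obtain ⟨R, hR⟩ : ∃ R : Finset (α × α), R = {p ∈ A1 ×ˢ A1 |
      (#{b' ∈ B | (p.1, b') ∈ E0 ∧ (p.2, b') ∈ E0} : ℝ) < γB} := ⟨_, rfl⟩
  rw [← hR] at hpoor
  have hA1A0 : A1 ⊆ A0 := by rw [hA1]; exact filter_subset _ A0
  have hRsub : R ⊆ A1 ×ˢ A1 := by rw [hR]; exact filter_subset _ _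
  -- `#A1 ≥ #A0/(3K) ≥ #A/(6K²)`
  have hA1card : (#A0 : ℝ) ≤ 3 * K * #A1 := by
    have h1 : (#A0 : ℝ) ^ 2 ≤ (3 * K * #A1) ^ 2 := by
      have h := hA1sq
      rw [div_le_iff₀ (by positivity)] at h
      nlinarith [sq_nonneg (#A1 : ℝ), sq_nonneg K]
    exact le_of_pow_le_pow_left₀ two_ne_zero (by positivity) h1
  have hA1card' : (#A : ℝ) / (6 * K ^ 2) ≤ #A1 := by
    rw [div_le_iff₀ (by positivity)]
    rw [div_le_iff₀ (by positivity)] at hA0card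
    nlinarith
  -- Step C: prune
  obtain ⟨T, hT⟩ : ∃ T : Finset α,
      T = {a ∈ A1 | (#{p ∈ R | p.1 = a} : ℝ) ≤ 2 * (1 / (32 * K)) * #A1} := ⟨_, rfl⟩
  have hTcard : (#A1 : ℝ) ≤ 2 * #T := by
    rw [hT]; exact two_mul_card_prune_ge A1 R hRsub hpoor
  have hTA1 : T ⊆ A1 := by rw [hT]; exact filter_subset _ A1
  have hTA0 : T ⊆ A0 := hTA1.trans hA1A0
  have hTcard' : (#A : ℝ) / (12 * K ^ 2) ≤ #T := by
    have : (#A : ℝ) / (12 * K ^ 2) = (#A : ℝ) / (6 * K ^ 2) / 2 := by ring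
    rw [this]; linarith
  have hTne : T.Nonempty := by
    rw [← card_pos, ← Nat.cast_pos (α := ℝ)]
    exact lt_of_lt_of_le (by positivity) hTcard'
  -- Step D: rich right vertices
  obtain ⟨B', hB'⟩ : ∃ B' : Finset β,
      B' = {b ∈ B | (#T : ℝ) / (4 * K) ≤ #{a ∈ T | (a, b) ∈ E0}} := ⟨_, rfl⟩
  have hB'card : (#B : ℝ) / (4 * K) ≤ #B' := by
    rw [hB']; exact card_richRight_ge T B E0 hE0B hTne hK0 fun a ha => hdegA0 a (hTA0 ha)
  have hB'B : B' ⊆ B := by rw [hB']; exact filter_subset _ B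
  refine ⟨T, hTA0.trans hA0A, B', hB'B, hTcard', hB'card, fun a ha b hb => ?_⟩
  -- Step E: paths from `a ∈ T` to `b ∈ B'`
  have haA1 : a ∈ A1 := hTA1 ha
  have hbdeg : (#T : ℝ) / (4 * K) ≤ #{a₁ ∈ T | (a₁, b) ∈ E0} := by
    rw [hB', mem_filter] at hb; exact hb.2
  obtain ⟨Nb, hNb⟩ : ∃ Nb : Finset α, Nb = {a₁ ∈ T | (a₁, b) ∈ E0} := ⟨_, rfl⟩
  rw [← hNb] at hbdeg
  obtain ⟨N, hN⟩ : ∃ N : Finset α,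
      N = {a₁ ∈ Nb | γB ≤ #{b' ∈ B | (a, b') ∈ E0 ∧ (a₁, b') ∈ E0}} := ⟨_, rfl⟩
  -- poor partners of `a` inside `Nb`
  have hpoorA : (#{a₁ ∈ Nb | ¬ γB ≤ #{b' ∈ B | (a, b') ∈ E0 ∧ (a₁, b') ∈ E0}} : ℝ) ≤
      2 * (1 / (32 * K)) * #A1 := by
    have ha' := ha
    rw [hT, mem_filter] at ha'
    refine le_trans ?_ ha'.2
    have : #{a₁ ∈ Nb | ¬ γB ≤ #{b' ∈ B | (a, b') ∈ E0 ∧ (a₁, b') ∈ E0}} ≤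
        #{p ∈ R | p.1 = a} := by
      refine Finset.card_le_card_of_injOn (fun a₁ => (a, a₁)) ?_ ?_
      · intro a₁ ha₁
        rw [mem_coe, mem_filter] at ha₁ ⊢
        obtain ⟨hNb₁, hlt⟩ := ha₁
        have ha₁T : a₁ ∈ T := by rw [hNb, mem_filter] at hNb₁; exact hNb₁.1
        refine ⟨?_, rfl⟩
        rw [hR, mem_filter, mem_product]
        exact ⟨⟨haA1, hTA1 ha₁T⟩, not_le.mp hlt⟩
      · intro a₁ _ a₁' _ h
        exact congrArg Prod.snd h
    exact_mod_cast this
  have hNcard : (#T : ℝ) / (8 * K) ≤ #N := by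
    have hsplit := Finset.card_filter_add_card_filter_not
      (s := Nb) (fun a₁ => γB ≤ #{b' ∈ B | (a, b') ∈ E0 ∧ (a₁, b') ∈ E0})
    have h1 : (#Nb : ℝ) =
        #N + #{a₁ ∈ Nb | ¬ γB ≤ #{b' ∈ B | (a, b') ∈ E0 ∧ (a₁, b') ∈ E0}} := by
      rw [hN]; exact_mod_cast hsplit.symm
    have h3 : 2 * (1 / (32 * K)) * (#A1 : ℝ) ≤ #T / (8 * K) := by
      rw [show 2 * (1 / (32 * K)) * (#A1 : ℝ) = #A1 / (16 * K) by ring]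
      rw [div_le_div_iff₀ (by positivity) (by positivity)]
      nlinarith
    have h4 : (#T : ℝ) / (4 * K) = #T / (8 * K) + #T / (8 * K) := by ring
    linarith
  -- count paths in `E0` through `N`, then pass to `E`
  have hNA0 : N ⊆ A0 := fun x hx => by
    rw [hN, mem_filter, hNb, mem_filter] at hx
    exact hTA0 hx.1.1
  have hNadj : ∀ a₁ ∈ N, (a₁, b) ∈ E0 := fun x hx => by
    rw [hN, mem_filter, hNb, mem_filter] at hx
    exact hx.1.2
  have hpaths0 := sum_codeg_le_card_paths A0 B E0 a b N hNA0 hNadj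
  have hsumN : (#N : ℝ) * γB ≤ ∑ a₁ ∈ N, (#{b₁ ∈ B | (a, b₁) ∈ E0 ∧ (a₁, b₁) ∈ E0} : ℝ) := by
    rw [← nsmul_eq_mul, ← sum_const]
    refine sum_le_sum fun a₁ ha₁ => ?_
    rw [hN, mem_filter] at ha₁
    exact ha₁.2
  have hmono : #{q ∈ B ×ˢ A0 | (a, q.1) ∈ E0 ∧ (q.2, q.1) ∈ E0 ∧ (q.2, b) ∈ E0} ≤
      #{q ∈ B ×ˢ A | (a, q.1) ∈ E ∧ (q.2, q.1) ∈ E ∧ (q.2, b) ∈ E} := by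
    refine card_le_card fun q hq => ?_
    rw [mem_filter, mem_product] at hq ⊢
    exact ⟨⟨hq.1.1, hA0A hq.1.2⟩, hE0E hq.2.1, hE0E hq.2.2.1, hE0E hq.2.2.2⟩
  have hγB' : γB = #B / (256 * K ^ 3) := by rw [hγB]; field_simp; ring
  have hγ0 : 0 ≤ γB := by rw [hγB']; positivity
  calc (#A : ℝ) * #B / (2 ^ 15 * K ^ 6)
      ≤ #A * #B / (12 * K ^ 2 * (8 * K) * (256 * K ^ 3)) := by
        have hc : (0 : ℝ) < 12 * K ^ 2 * (8 * K) * (256 * K ^ 3) := by positivity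
        have hnum : (0 : ℝ) ≤ #A * #B := mul_nonneg (Nat.cast_nonneg _) (Nat.cast_nonneg _)
        have hle : 12 * K ^ 2 * (8 * K) * (256 * K ^ 3) ≤ (2 : ℝ) ^ 15 * K ^ 6 := by
          have e : 12 * K ^ 2 * (8 * K) * (256 * K ^ 3) = (24576 : ℝ) * K ^ 6 := by ring
          rw [e, show (2 : ℝ) ^ 15 = 32768 by norm_num]
          exact mul_le_mul_of_nonneg_right (by norm_num) (pow_pos hK0 6).le
        exact div_le_div_of_nonneg_left hnum hc hle
    _ = (#A / (12 * K ^ 2)) / (8 * K) * (#B / (256 * K ^ 3)) := by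
        rw [div_div, div_mul_div_comm]
    _ ≤ (#T : ℝ) / (8 * K) * γB := by
        rw [hγB']; gcongr
    _ ≤ #N * γB := mul_le_mul_of_nonneg_right hNcard hγ0
    _ ≤ ∑ a₁ ∈ N, (#{b₁ ∈ B | (a, b₁) ∈ E0 ∧ (a₁, b₁) ∈ E0} : ℝ) := hsumN
    _ ≤ #{q ∈ B ×ˢ A0 | (a, q.1) ∈ E0 ∧ (q.2, q.1) ∈ E0 ∧ (q.2, b) ∈ E0} := by
        exact_mod_cast hpaths0
    _ ≤ #{q ∈ B ×ˢ A | (a, q.1) ∈ E ∧ (q.2, q.1) ∈ E ∧ (q.2, b) ∈ E} := by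
        exact_mod_cast hmono

end Summit.Parity.GeneralizedHardyLittlewood.GreenTaoLevelTwoGITwoCyclicInverse
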